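import Mathlib
import HarnessLib
import Summits.ResolutionOfSingularities.ResolutionOfSingularities.Theorems.WildQuotientsWildQuotientResolutionS1aWithinIn

/-!
# S1a — THE K-FREE FRAME: bounded strategy trees lowering `(dim Z, #top components, #components)` of the TYPED bad locus WIN

[OURS · L1 W4.5c · lead-1 g11; FINDING F12 «named kills need no agreement» / proposal v12-KF (STATUS 2026-08-28)] — NOT statements of the manuscript;
counted 0; AI-level work, weaker than expert review. Crux stmt-ResolutionOfSingularities-17941 `CyclicQuotientFourfolds`, line `s1a-logminvertex` (v11 → v12-KF
candidate). Route-independent. SEMANTICS: the TYPED bad locus `M.badLocus` only; no killability notion, no transport, no agreement.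

WHY. Every obstruction found on the K side (F10 typed vs formal badness / ADD-BAD; F11 agreement across unrelated node rings; ADD-NP for the np-atlas) comes
from one design decision: K must SYNTHESISE a global principal centre from anonymous, persistent, pointwise `KillableAt` witnesses. If instead the party that
CREATES a kill NAMES it (one global `(𝒦, d)` with `IsPrincipalCentre`, verified chart by chart in its own coordinates) and the strategy executes it at once,
nothing has to be synthesised, glued, transported or tightened, and badness is never proved (only goodness: killed ⇒ good). What the frame then needs is
only a MEASURE on the typed bad locus that every completed step lowers.

* `GModel.zTop M := nTopComp Z(M)`, `GModel.zComp M := nIrrComp Z(M)`; the lexicographic order `GModel.LexLT M' M` on `(ν₁, zTop, zComp)`;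
* `nTopComp_le_of_isEmbedding` — an embedding of spaces of equal finite dimension does not increase the number of top components (injection
  `T' ↦ closure (ψ '' T')`, `closure_image_mem_topComponents` p621949);
* ★ `GModel.lexLT_of_principalMove` — **a KILL MOVE LOWERS THE MEASURE**: along a move blowing up a principal centre whose support meets `Z(M)`:
  `Z(M') ≅ Z(M) ∖ supp` (`exists_isEmbedding_badLocus_principalMove` p620846) ⇒ `ν₁' ≤ ν₁`, `zTop' ≤ zTop` when `ν₁' = ν₁`, `zComp' < zComp` (p620488);
* `GModel.TreeIn P Q n M` — a strategy TREE of depth `≤ n` from `M`: at each inner node an ADMISSIBLE centre, every realised move stays in the class `P`,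
  every leaf satisfies `Q`; `wins_of_treeIn`; ★★ `wins_of_reachLowerIn` — if from every non-terminal `P`-model some bounded tree reaches models of LOWER
  measure, every `P`-model WINS (lexicographic induction, pattern of `wins_of_touchOrTopOrOrbitSeq_in`);
* research def `ReachLowerIn p` (OURS CANDIDATE, asserted nowhere; binders VERBATIM those of `AuxWithinIn`): ∃ class `P ∋ initial` such that from every
  non-terminal `P`-model a bounded strategy tree inside `P` reaches models of lower `(ν₁, zTop, zComp)`; ★ `winningStrategy_of_reachLowerIn`,
  `cyclicQuotientFourfolds_of_door_of_reachLowerIn`; and NOTHING IS LOST: `treeIn_one_of_killNow` (an immediate kill is a depth-1 tree).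
The second tool — «AUX move whose support contains a top component, then ≤ k immediate kills clearing the bad points over the support ⇒ lower measure» —
follows in `…S1aKillFreeAux`.
-/

set_option linter.dupNamespace false

noncomputable section

open CategoryTheory Limits AlgebraicGeometry TopologicalSpace Topology
open Literature.AlgebraicGeometry.Resolution Literature.AlgebraicGeometry.RelativeSpec
open Summit.ResolutionOfSingularities.ResolutionOfSingularities.Theorems.WildQuotientResolution.S1
open Summit.ResolutionOfSingularities.ResolutionOfSingularities.Theorems.WildQuotientResolution.S1.NodeAtlas
open Summit.ResolutionOfSingularities.ResolutionOfSingularities.Theorems.WildQuotientResolution.S1.CompCount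
open Summit.ResolutionOfSingularities.ResolutionOfSingularities.Theorems.WildQuotientResolution.S1.TopComponents

namespace Summit.ResolutionOfSingularities.ResolutionOfSingularities.Theorems.WildQuotientResolution.S1

/-! ## Top components under embeddings of equal dimension -/

section Top

universe u v

variable {X : Type u} {Y : Type v} [TopologicalSpace X] [TopologicalSpace Y]

/-- **An embedding of spaces of the same finite dimension does not increase the number of top components** (`X` with finitely many irreducible
components): `T' ↦ closure (ψ '' T')` injects `topComponents Y` into `topComponents X`. [OURS · L1 W4.5c] -/
theorem nTopComp_le_of_isEmbedding {ψ : Y → X} (hψ : IsEmbedding ψ) {k : ℕ} (hX : topologicalKrullDim X = k) (hY : topologicalKrullDim Y = k)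
    (hfin : (irreducibleComponents X).Finite) : TopCount.nTopComp Y ≤ TopCount.nTopComp X := by
  let Φ : Set Y → Set X := fun T' => closure (ψ '' T')
  have hmaps : Set.MapsTo Φ (TopCount.topComponents Y) (TopCount.topComponents X) := by
    intro T' hT'
    have hdT' : topologicalKrullDim ↥T' = k := hT'.2.trans hY
    obtain ⟨hmem, hdim⟩ := TopCount.closure_image_mem_topComponents hψ hX.le hT'.1 hdT'
    exact ⟨hmem, hdim.trans hX.symm⟩
  have hinj : Set.InjOn Φ (TopCount.topComponents Y) := by
    intro T₁ h₁ T₂ h₂ h12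
    have e1 := TopCount.image_eq_closure_inter_range hψ (isClosed_of_mem_irreducibleComponents _ h₁.1)
    have e2 := TopCount.image_eq_closure_inter_range hψ (isClosed_of_mem_irreducibleComponents _ h₂.1)
    have himg : ψ '' T₁ = ψ '' T₂ := by rw [e1, e2]; exact congrArg (· ∩ Set.range ψ) h12
    exact (Set.image_eq_image hψ.injective).mp himg
  exact Set.ncard_le_ncard_of_injOn Φ hmaps hinj (hfin.subset (TopCount.topComponents_subset X))

end Top

namespace GameFrame.GModel

variable {p : ℕ} {X' X₁ : Scheme.{0}} {q : X' ⟶ X₁} {G : Type} [Group G] {ρ : G →* Aut X'} {g₀ : G}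

/-! ## The measure `(ν₁, zTop, zComp)` on the typed bad locus -/

/-- Number of top-dimensional irreducible components of the bad locus. [OURS · L1 W4.5c · v12-KF] -/
def zTop (M : GModel p q G ρ g₀) : ℕ := TopCount.nTopComp ↥M.badLocus

/-- Number of irreducible components of the bad locus. [OURS · L1 W4.5c · v12-KF] -/
def zComp (M : GModel p q G ρ g₀) : ℕ := nIrrComp ↥M.badLocus

/-- **The lexicographic order on `(ν₁, zTop, zComp)`.** [OURS · L1 W4.5c · v12-KF] -/
def LexLT (M' M : GModel p q G ρ g₀) : Prop :=
  M'.nu1 < M.nu1 ∨ (M'.nu1 = M.nu1 ∧ (M'.zTop < M.zTop ∨ (M'.zTop = M.zTop ∧ M'.zComp < M.zComp)))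

/-- ★ **A KILL MOVE LOWERS THE MEASURE**: a move along a principal centre whose support meets the bad locus satisfies `LexLT M' M`
(Noetherian base, compact model). [OURS · L1 W4.5c · v12-KF] -/
theorem lexLT_of_principalMove [Finite G] (hp : p.Prime) (hG : ∀ g : G, g ∈ Subgroup.zpowers g₀) (M M' : GModel p q G ρ g₀)
    (hB : M.HasNoetherianBase) [CompactSpace M.V] {n : ℕ} (hnu : M.nu1 < n) (𝒦 : ReesFiltration M.V) (d : ℕ)
    (hkill : IsPrincipalCentre p M.act g₀ 𝒦 d) (htouch : (M.badLocus ∩ ((𝒦.ideal d).support : Set M.V)).Nonempty) (hmv : M.IsMoveOf M' 𝒦 d) :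
    LexLT M' M := by
  have hfin := M.finite_irreducibleComponents_badLocus
  have hcomp : M'.zComp < M.zComp := nIrrComp_badLocus_principalMove_lt hp hG M M' 𝒦 d hkill hB hfin htouch hmv
  obtain ⟨π', hbl, -, hr, hcomm⟩ := hmv
  obtain ⟨R₀, _, _, s, _, hs⟩ := hB
  obtain ⟨φ, hφ, -, -⟩ := exists_isEmbedding_badLocus_principalMove hp hG M M' 𝒦 d hkill π' hbl hr hcomm s hs
  have hle : M'.nu1 ≤ M.nu1 := hφ.isInducing.topologicalKrullDim_le
  rcases hle.lt_or_eq with hlt | heq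
  · exact Or.inl hlt
  refine Or.inr ⟨heq, ?_⟩
  -- the bad locus downstairs is non-empty, so `ν₁` is a natural number
  have hbot : M.nu1 ≠ ⊥ := by
    obtain ⟨v, hv, -⟩ := htouch
    intro hbot
    rw [nu1, topologicalKrullDim, Order.krullDim_eq_bot_iff] at hbot
    exact hbot.elim ⟨closure {(⟨v, hv⟩ : ↥M.badLocus)}, isIrreducible_singleton.closure, isClosed_closure⟩
  obtain ⟨k, hk⟩ := exists_nat_eq_of_ne_bot_of_lt hbot hnu
  have htop : M'.zTop ≤ M.zTop := nTopComp_le_of_isEmbedding hφ hk (heq.trans hk) hfin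
  rcases htop.lt_or_eq with h | h
  · exact Or.inl h
  · exact Or.inr ⟨h, hcomp⟩

/-! ## Strategy trees and the winning induction -/

/-- **Strategy tree of depth `≤ n` from `M` inside the class `P` with leaves in `Q`**: either `M` is already a leaf (`Q M`), or an ADMISSIBLE centre is
chosen at `M` and every realised move lies in `P` and carries a tree of depth `≤ n − 1`. [OURS · L1 W4.5c · v12-KF] -/
def TreeIn (P Q : GModel p q G ρ g₀ → Prop) : ℕ → GModel p q G ρ g₀ → Prop
  | 0, M => Q M
  | n + 1, M => Q M ∨ ∃ (𝒦 : ReesFiltration M.V) (d : ℕ), IsAdmissibleCentre p M.act g₀ 𝒦 d ∧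
      ∀ M' : GModel p q G ρ g₀, M.IsMoveOf M' 𝒦 d → P M' ∧ TreeIn P Q n M'

/-- Deeper trees contain shallower ones. -/
theorem TreeIn.mono {P Q : GModel p q G ρ g₀ → Prop} : ∀ {n m : ℕ} (M : GModel p q G ρ g₀), n ≤ m → TreeIn P Q n M → TreeIn P Q m M
  | 0, 0, _, _, h => h
  | 0, _ + 1, _, _, h => Or.inl h
  | _ + 1, 0, _, hnm, _ => absurd hnm (Nat.not_succ_le_zero _)
  | n + 1, m + 1, M, hnm, h => by
      rcases h with h | ⟨𝒦, d, hadm, hmv⟩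
      · exact Or.inl h
      · exact Or.inr ⟨𝒦, d, hadm, fun M' hm => ⟨(hmv M' hm).1, TreeIn.mono M' (Nat.succ_le_succ_iff.mp hnm) (hmv M' hm).2⟩⟩

/-- **A tree whose leaves win makes its root win.** [OURS · L1 W4.5c · v12-KF] -/
theorem wins_of_treeIn {P Q : GModel p q G ρ g₀ → Prop} (hQ : ∀ N : GModel p q G ρ g₀, P N → Q N → Wins p q G ρ g₀ N) :
    ∀ (n : ℕ) (M : GModel p q G ρ g₀), P M → TreeIn P Q n M → Wins p q G ρ g₀ M
  | 0, M, hPM, h => hQ M hPM h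
  | n + 1, M, hPM, h => by
      rcases h with h | ⟨𝒦, d, hadm, hmv⟩
      · exact hQ M hPM h
      · exact Wins.of_moves 𝒦 d hadm fun M' hm => wins_of_treeIn hQ n M' (hmv M' hm).1 (hmv M' hm).2

/-- ★★ **BOUNDED TREES REACHING LOWER MEASURE WIN.** If from every non-terminal model of the class `P` some bounded strategy tree inside `P` reaches
models of lexicographically lower `(ν₁, zTop, zComp)`, then every `P`-model (with `ν₁` finite) wins. [OURS · L1 W4.5c · v12-KF] -/
theorem wins_of_reachLowerIn (P : GModel p q G ρ g₀ → Prop) (hnu : ∀ M : GModel p q G ρ g₀, P M → ∃ n : ℕ, M.nu1 < n)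
    (H : ∀ M : GModel p q G ρ g₀, P M → ¬ M.Terminal → ∃ n : ℕ, TreeIn P (fun N => LexLT N M) n M)
    (M₀ : GModel p q G ρ g₀) (hP₀ : P M₀) : Wins p q G ρ g₀ M₀ := by
  obtain ⟨n₀, hn₀⟩ := hnu M₀ hP₀
  suffices main : ∀ (a : ℕ) (M : GModel p q G ρ g₀), P M → M.nu1 < a → Wins p q G ρ g₀ M from main n₀ M₀ hP₀ hn₀
  intro a
  induction a using Nat.strong_induction_on with
  | _ a iha =>
    have drop : ∀ M N : GModel p q G ρ g₀, P N → M.nu1 < a → N.nu1 < M.nu1 → Wins p q G ρ g₀ N := fun M N hPN ha hj => by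
      cases a with
      | zero => exact absurd (withBot_eq_bot_of_lt_zero ha ▸ hj) not_lt_bot
      | succ a' => exact iha a' (Nat.lt_succ_self a') N hPN (lt_of_lt_of_le hj (withBot_le_of_lt_succ ha))
    -- inner induction on `zTop`, then on `zComp`
    have level : ∀ (b c : ℕ) (M : GModel p q G ρ g₀), P M → M.nu1 < a → M.zTop < b → M.zComp < c → Wins p q G ρ g₀ M := by
      intro b
      induction b with
      | zero => exact fun c M _ _ hb _ => absurd hb (Nat.not_lt_zero _)
      | succ b ihb =>
        intro c
        induction c with
        | zero => exact fun M _ _ _ hc => absurd hc (Nat.not_lt_zero _)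
        | succ c ihc =>
          intro M hPM ha hb hc
          by_cases hT : M.Terminal
          · exact Wins.terminal M hT
          obtain ⟨n, htree⟩ := H M hPM hT
          refine wins_of_treeIn (fun N hPN hlex => ?_) n M hPM htree
          rcases hlex with hlt | ⟨heq, hlt | ⟨heq', hlt'⟩⟩
          · exact drop M N hPN ha hlt
          · exact ihb (N.zComp + 1) N hPN (heq ▸ ha) (lt_of_lt_of_le hlt (Nat.lt_succ_iff.mp hb)) (Nat.lt_succ_self _)
          · exact ihc N hPN (heq ▸ ha) (heq' ▸ hb) (lt_of_lt_of_le hlt' (Nat.lt_succ_iff.mp hc))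
    intro M hPM ha
    exact level (M.zTop + 1) (M.zComp + 1) M hPM ha (Nat.lt_succ_self _) (Nat.lt_succ_self _)

/-- **An immediate KILL is a depth-1 tree** reaching lower measure: a principal centre meeting `Z(M)` all of whose moves stay in `P`.
[OURS · L1 W4.5c · v12-KF] -/
theorem treeIn_one_of_killNow [Finite G] (hp : p.Prime) (hG : ∀ g : G, g ∈ Subgroup.zpowers g₀) {P : GModel p q G ρ g₀ → Prop}
    (M : GModel p q G ρ g₀) (hB : M.HasNoetherianBase) [CompactSpace M.V] {n : ℕ} (hnu : M.nu1 < n)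
    (𝒦 : ReesFiltration M.V) (d : ℕ) (hkill : IsPrincipalCentre p M.act g₀ 𝒦 d)
    (htouch : (M.badLocus ∩ ((𝒦.ideal d).support : Set M.V)).Nonempty) (hP : ∀ M' : GModel p q G ρ g₀, M.IsMoveOf M' 𝒦 d → P M') :
    TreeIn P (fun N => LexLT N M) 1 M :=
  Or.inr ⟨𝒦, d, isAdmissibleCentre_of_isPrincipalCentre hkill, fun M' hm =>
    ⟨hP M' hm, lexLT_of_principalMove hp hG M M' hB hnu 𝒦 d hkill htouch hm⟩⟩

end GameFrame.GModel

/-! ## The research statement and the skeleton-v12-KF derivations -/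

/-- **`ReachLowerIn p`** (OURS CANDIDATE research statement, asserted nowhere; binders VERBATIM those of `AuxWithinIn`): for every datum of the crux there is
a class `P` of models containing the initial model such that from every non-terminal `P`-model some BOUNDED STRATEGY TREE inside `P` reaches models of
lexicographically lower `(ν₁, zTop, zComp)` = (dimension, number of top components, number of components of the TYPED bad locus). Tools: an immediate
kill is such a tree (`treeIn_one_of_killNow`); «aux move containing a top component, then immediate kills clearing its exceptional bad points» is one
(`…S1aKillFreeAux`). [OURS · L1 W4.5c · v12-KF] -/
def ReachLowerIn (p : ℕ) : Prop :=
  ∀ (k : Type) [Field k] [CharP k p] [PerfectField k] (X' X₁ : Scheme.{0})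
    (f : X₁ ⟶ Spec (.of k)) (q : X' ⟶ X₁) (G : Type) [Group G] [Finite G]
    (ρ : G →* Aut X'), Nat.card G = p → IsSeparated f → LocallyOfFiniteType f → QuasiCompact f →
    IsIntegral X₁ → ∀ [IsIntegral X'], Scheme.IsRegular X' → IsFinite q → Function.Surjective q.base →
    (∃ U : X₁.Opens, Dense (U : Set X₁) ∧ Etale (q ∣_ U)) →
    ∀ (hq : ∀ g : G, (ρ g).hom ≫ q = q),
    (∀ x y : X', q.base x = q.base y → ∃ g : G, (ρ g).hom.base x = y) →
    topologicalKrullDim X₁ ≤ 4 → Function.Injective ρ →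
    ∀ (g₀ : G), (∀ g : G, g ∈ Subgroup.zpowers g₀) → ∀ [IsLocallyNoetherian X']
      (h₀ : NodeAtlas p (⟨ρ, hq⟩ : ActionOver q G) g₀),
      ∃ P : GameFrame.GModel p q G ρ g₀ → Prop,
        P (GameFrame.GModel.initial hq h₀) ∧
        ∀ M : GameFrame.GModel p q G ρ g₀, P M → ¬ M.Terminal →
          ∃ n : ℕ, GameFrame.GModel.TreeIn P (fun N => GameFrame.GModel.LexLT N M) n M

/-- ★ **`ReachLowerIn p ⇒ WinningStrategy p`.** [OURS · L1 W4.5c · v12-KF] -/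
theorem winningStrategy_of_reachLowerIn {p : ℕ} (h : ReachLowerIn p) : FrameWins.WinningStrategy p := by
  intro k _ _ _ X' X₁ f q G _ _ ρ hG hfs hfft hfqc hX₁ _ hreg hqfin hqs hqet hq horb hdim hinj g₀ hg₀ _ h₀
  haveI := hfft
  haveI := hfqc
  haveI := hqfin
  obtain ⟨P, hP₀, H⟩ := h k X' X₁ f q G ρ hG hfs hfft hfqc hX₁ hreg hqfin hqs hqet hq horb hdim hinj g₀ hg₀ h₀
  exact GameFrame.GModel.wins_of_reachLowerIn P (fun M _ => GameFrame.GModel.exists_nat_nu1_lt_of_datum f M) H _ hP₀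

/-- **Door + `ReachLowerIn` ⇒ the sub-crux `CyclicQuotientFourfolds`** (skeleton v12-KF composition pattern). [OURS · L1 W4.5c · v12-KF] -/
theorem cyclicQuotientFourfolds_of_door_of_reachLowerIn (hD : FrameWins.DoorStatement) (h : ∀ p : ℕ, p.Prime → ReachLowerIn p) :
    Summit.ResolutionOfSingularities.ResolutionOfSingularities.Theses.WildQuotients.CyclicQuotientFourfolds :=
  FrameWins.cyclicQuotientFourfolds_of_door_of_wins hD fun p hp _ => winningStrategy_of_reachLowerIn (h p hp)

end Summit.ResolutionOfSingularities.ResolutionOfSingularities.Theorems.WildQuotientResolution.S1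

end
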